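import Literature.NumberTheory.LFunctions.ZetaZerosShortIntervalsGG
import Literature.NumberTheory.LFunctions.VonMangoldtWeightedSums
import HarnessLib

/-!
# Soundararajan's `V`-typical ordinates (Balazard–de Roton 2010, §5.1) and Prop. 9 / BR2008 Prop. 18

Topic `Literature/NumberTheory/LFunctions`. This file DEFINES the notion of a `V`-typical ordinate
of size `T` (K. Soundararajan, *Partial sums of the Möbius function*, J. reine angew. Math. 631
(2009), §§5–6, in the form of M. Balazard–A. de Roton, arXiv:0812.1689, §5.1) and PROVES, under
RH, that for `V` in the top range every ordinate is `V`-typical (BdR2010 Prop. 9 = M. Balazard,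
A. de Roton, arXiv:0810.3587, Prop. 18).

BdR2010 §5.1: let `0 < δ ≤ 1`, `T` large and `(log log T)² ≤ V ≤ log T/log log T`. A real `t` is
a *`V`-typical ordinate of size `T`* if `T ≤ t ≤ 2T` and
(i) for all `σ ≥ 1/2`, `|Σ_{n ≤ x} Λ(n)/(n^{σ+it} log n) · log(x/n)/log x| ≤ 2V`, where `x = T^{1/V}`;
(ii) every subinterval of `[t−1, t+1]` of length `2πδV/log T` contains at most `(1+δ)V` ordinates
of zeros of `ζ`;
(iii) every subinterval of `[t−1, t+1]` of length `2πV/((log V) log T)` contains at most `V`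
ordinates of zeros of `ζ`.
We read "the subinterval `]u, u+ℓ]` contains `N(u+ℓ) − N(u)` ordinates" (counted with
multiplicity, `N = zetaZeroCount`), which is how (ii), (iii) are established (Prop. 18) and used
(Props. 7, 8 of arXiv:0810.3587).

* `Literature.NumberTheory.LFunctions.typicalPrimeSum T V σ t` — the sum in (i);
* `Literature.NumberTheory.LFunctions.IsVTypical δ T V t` — the structure (i)–(iii);
* `Literature.NumberTheory.LFunctions.norm_typicalPrimeSum_le` — the Chebyshev bound for (i);
* `Literature.NumberTheory.LFunctions.isVTypical_of_RH` — **BdR2010 Prop. 9** (= BR2008 Prop. 18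
  with the sharper threshold of the 2010 paper): under RH, for `0 < δ ≤ 1` there is `T₀ = T₀(δ)`
  such that for `T ≥ T₀`, `(1/2 + (1/2 + δ) log log log T/log log T) log T/log log T ≤ V ≤ log T/log log T`
  and `T ≤ t ≤ 2T`, `t` is `V`-typical of size `T`.

## References

* [BalazardDeRoton2010] M. Balazard, A. de Roton, arXiv:0812.1689, §5.1 and Prop. 9.
  [cite: BalazardDeRoton2010, §5.1]
* [BalazardDeRoton2008] M. Balazard, A. de Roton, arXiv:0810.3587, Prop. 18.
  [cite: BalazardDeRoton2008, Prop. 18]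
* K. Soundararajan, J. reine angew. Math. 631 (2009), 141–152.
-/

noncomputable section

open Complex Filter Set Topology Finset ArithmeticFunction
open scoped Real

namespace Literature.NumberTheory.LFunctions

/-- The smoothed prime sum of condition (i): `Σ_{n ≤ x} Λ(n)/(n^{σ+it} log n) · log(x/n)/log x`
with `x = T^{1/V}`. [cite: BalazardDeRoton2010, §5.1 (i)] -/
def typicalPrimeSum (T V σ t : ℝ) : ℂ :=
  ∑ n ∈ Finset.Icc 0 ⌊T ^ (1 / V)⌋₊,
    (Λ n : ℂ) / ((n : ℂ) ^ ((σ : ℂ) + (t : ℂ) * I) * (Real.log n : ℂ)) *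
      ((Real.log (T ^ (1 / V) / n) / Real.log (T ^ (1 / V)) : ℝ) : ℂ)

/-- **`V`-typical ordinate of size `T`** (Soundararajan; Balazard–de Roton 2010, §5.1), with
parameter `δ`: `T ≤ t ≤ 2T`, (i) the smoothed prime sums at `σ + it`, `σ ≥ 1/2`, are `≤ 2V` in
modulus, (ii) `N(u + 2πδV/log T) − N(u) ≤ (1+δ)V` and (iii) `N(u + 2πV/((log V) log T)) − N(u) ≤ V`
for all such windows inside `[t−1, t+1]`. [cite: BalazardDeRoton2010, §5.1] -/
structure IsVTypical (δ T V t : ℝ) : Prop where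
  ge : T ≤ t
  le : t ≤ 2 * T
  primeSum : ∀ σ : ℝ, 1 / 2 ≤ σ → ‖typicalPrimeSum T V σ t‖ ≤ 2 * V
  zeros_delta : ∀ u : ℝ, t - 1 ≤ u → u + 2 * π * δ * V / Real.log T ≤ t + 1 →
    ((zetaZeroCount (u + 2 * π * δ * V / Real.log T) : ℝ) - zetaZeroCount u) ≤ (1 + δ) * V
  zeros_logV : ∀ u : ℝ, t - 1 ≤ u → u + 2 * π * V / (Real.log V * Real.log T) ≤ t + 1 →
    ((zetaZeroCount (u + 2 * π * V / (Real.log V * Real.log T)) : ℝ) - zetaZeroCount u) ≤ V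

namespace VTypical

/-- The modulus of a term of the smoothed prime sum: for `σ ≥ 1/2` and `n ≤ x`,
`‖Λ(n)/(n^{σ+it} log n) · log(x/n)/log x‖ ≤ Λ(n)/(√n log n) · log(x/n) / log x`. [folklore] -/
theorem norm_term_le {x σ t : ℝ} (hx : 1 < x) (hσ : 1 / 2 ≤ σ) {n : ℕ} (hn : n ∈ Finset.Icc 0 ⌊x⌋₊) :
    ‖(Λ n : ℂ) / ((n : ℂ) ^ ((σ : ℂ) + (t : ℂ) * I) * (Real.log n : ℂ)) * ((Real.log (x / n) / Real.log x : ℝ) : ℂ)‖ ≤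
      (Λ n : ℝ) / (Real.sqrt n * Real.log n) * Real.log (x / n) / Real.log x := by
  have hlogx : 0 < Real.log x := Real.log_pos hx
  rcases Nat.lt_or_ge n 2 with hn2 | hn2
  · interval_cases n <;> simp
  have hn0 : (0 : ℝ) < n := by exact_mod_cast (by omega : 0 < n)
  have hn1 : (1 : ℝ) ≤ n := by exact_mod_cast (by omega : 1 ≤ n)
  have hnx : (n : ℝ) ≤ x := by
    rw [Finset.mem_Icc] at hn
    exact (Nat.cast_le.2 hn.2).trans (Nat.floor_le (by linarith))
  have hlogn : 0 < Real.log n := Real.log_pos (by exact_mod_cast hn2)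
  have hw0 : 0 ≤ Real.log (x / n) := Real.log_nonneg (by rw [le_div_iff₀ hn0]; linarith)
  have hpow : ‖(n : ℂ) ^ ((σ : ℂ) + (t : ℂ) * I)‖ = (n : ℝ) ^ σ := by
    rw [Complex.norm_natCast_cpow_of_pos (by omega)]
    simp
  have hpow_ge : Real.sqrt n ≤ (n : ℝ) ^ σ := by
    rw [Real.sqrt_eq_rpow]
    exact Real.rpow_le_rpow_of_exponent_le hn1 hσ
  rw [norm_mul, norm_div, norm_mul, hpow, Complex.norm_real, Complex.norm_real, Complex.norm_real,
    Real.norm_eq_abs, Real.norm_eq_abs, Real.norm_eq_abs, abs_of_nonneg vonMangoldt_nonneg,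
    abs_of_pos hlogn, abs_of_nonneg (div_nonneg hw0 hlogx.le)]
  rw [mul_div_assoc]
  refine mul_le_mul_of_nonneg_right ?_ (div_nonneg hw0 hlogx.le)
  refine div_le_div_of_nonneg_left vonMangoldt_nonneg (by positivity) ?_
  exact mul_le_mul_of_nonneg_right hpow_ge hlogn.le

end VTypical

open VTypical in
/-- **The Chebyshev bound for condition (i)**: for `x = T^{1/V} ≥ 2` and `σ ≥ 1/2`,
`‖typicalPrimeSum T V σ t‖ ≤ 1320 √x/(log x)² + (7/2)(log log x + 4)`.
[cite: BalazardDeRoton2008, Prop. 18 (proof of (i))] -/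
theorem norm_typicalPrimeSum_le {T V σ t : ℝ} (hx : 2 ≤ T ^ (1 / V)) (hσ : 1 / 2 ≤ σ) :
    ‖typicalPrimeSum T V σ t‖ ≤
      1320 * Real.sqrt (T ^ (1 / V)) / Real.log (T ^ (1 / V)) ^ 2 +
        (7 / 2) * (Real.log (Real.log (T ^ (1 / V))) + 4) := by
  set x : ℝ := T ^ (1 / V) with hxdef
  have hx1 : 1 < x := by linarith
  have hlogx : 0 < Real.log x := Real.log_pos hx1
  unfold typicalPrimeSum
  rw [← hxdef]
  refine (norm_sum_le _ _).trans ?_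
  refine (Finset.sum_le_sum fun n hn ↦ norm_term_le (t := t) hx1 hσ hn).trans ?_
  rw [← Finset.sum_div, div_le_iff₀ hlogx]
  refine (vonMangoldt_weighted_sum_le hx).trans (le_of_eq ?_)
  field_simp

/-! ## Prop. 18: for `V` in the top range every ordinate is `V`-typical -/

namespace VTypical

/-- Eventual conditions on `a = log T` for Prop. 18 (the last one depends on `δ`). [folklore] -/
theorem eventually_conditions_typical (δ : ℝ) :
    ∀ᶠ a : ℝ in atTop, 4 ≤ a ∧ 2 * π ≤ Real.log a ∧ 2 * Real.log (Real.log a) + 2 ≤ Real.log a ∧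
      2640 ≤ Real.log a ∧ 7 * (Real.log (Real.log a) + 5) * Real.log a ≤ a ∧
      4 / δ ≤ Real.log (Real.log a) := by
  have hlog : Tendsto Real.log atTop atTop := Real.tendsto_log_atTop
  have hloglog : Tendsto (fun a ↦ Real.log (Real.log a)) atTop atTop := hlog.comp hlog
  have h1 : ∀ᶠ a : ℝ in atTop, 4 ≤ a := eventually_ge_atTop 4
  have h2 : ∀ᶠ a : ℝ in atTop, 2 * π ≤ Real.log a := hlog.eventually_ge_atTop _
  have h3 : ∀ᶠ a : ℝ in atTop, 2 * Real.log (Real.log a) + 2 ≤ Real.log a := by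
    have ho := (Real.isLittleO_log_id_atTop.comp_tendsto hlog).bound (by norm_num : (0 : ℝ) < 1 / 4)
    have h4 : ∀ᶠ a : ℝ in atTop, 4 ≤ Real.log a := hlog.eventually_ge_atTop 4
    filter_upwards [ho, h4] with a ha ha4
    simp only [Function.comp, Real.norm_eq_abs, id] at ha
    rw [abs_of_pos (by linarith : 0 < Real.log a)] at ha
    have := (le_abs_self _).trans ha
    linarith
  have h4 : ∀ᶠ a : ℝ in atTop, 2640 ≤ Real.log a := hlog.eventually_ge_atTop _
  have h5 : ∀ᶠ a : ℝ in atTop, 7 * (Real.log (Real.log a) + 5) * Real.log a ≤ a := by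
    -- `log log a + 5 ≤ 2 log a` eventually and `14 (log a)² ≤ a` eventually
    have ho := (Real.isLittleO_pow_log_id_atTop (n := 2)).bound (by norm_num : (0 : ℝ) < 1 / 14)
    have h6 : ∀ᶠ a : ℝ in atTop, 5 ≤ Real.log a := hlog.eventually_ge_atTop 5
    filter_upwards [ho, h1, h3, h6] with a ha ha1 ha3 ha6
    rw [Real.norm_eq_abs, Real.norm_eq_abs, id, abs_of_pos (by linarith : (0 : ℝ) < a),
      abs_of_nonneg (by positivity)] at ha
    have hll : Real.log (Real.log a) + 5 ≤ 2 * Real.log a := by linarith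
    have hla : 0 ≤ Real.log a := by linarith
    calc 7 * (Real.log (Real.log a) + 5) * Real.log a ≤ 7 * (2 * Real.log a) * Real.log a := by
          gcongr
      _ = 14 * Real.log a ^ 2 := by ring
      _ ≤ a := by linarith
  have h6 : ∀ᶠ a : ℝ in atTop, 4 / δ ≤ Real.log (Real.log a) := hloglog.eventually_ge_atTop _
  filter_upwards [h1, h2, h3, h4, h5, h6] with a a1 a2 a3 a4 a5 a6
  exact ⟨a1, a2, a3, a4, a5, a6⟩

end VTypical

open VTypical in
/-- **Balazard–de Roton 2010, Prop. 9 (= arXiv:0810.3587, Prop. 18, with the 2010 threshold), under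
RH**: for `0 < δ ≤ 1` there is `T₀ = T₀(δ)` such that for `T ≥ T₀`,
`(1/2 + (1/2 + δ) log log log T/log log T) · log T/log log T ≤ V ≤ log T/log log T` and `T ≤ t ≤ 2T`,
the ordinate `t` is `V`-typical of size `T` (with parameter `δ`).
[cite: BalazardDeRoton2010, Prop. 9] -/
theorem isVTypical_of_RH (hRH : RiemannHypothesis) {δ : ℝ} (hδ0 : 0 < δ) (hδ1 : δ ≤ 1) :
    ∃ T₀ : ℝ, ∀ T : ℝ, T₀ ≤ T → ∀ V : ℝ,
      (1 / 2 + (1 / 2 + δ) * (Real.log (Real.log (Real.log T)) / Real.log (Real.log T))) *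
          (Real.log T / Real.log (Real.log T)) ≤ V →
      V ≤ Real.log T / Real.log (Real.log T) → ∀ t : ℝ, T ≤ t → t ≤ 2 * T → IsVTypical δ T V t := by
  obtain ⟨T₁, hT₁⟩ := zetaZeroCount_short_interval_GG_uniform_of_RH hRH (by positivity : (0 : ℝ) < δ / 2)
  obtain ⟨a₀, ha₀⟩ := Filter.eventually_atTop.1 (eventually_conditions_typical δ)
  refine ⟨max T₁ (Real.exp a₀), fun T hT V hVl hVu t htl htu ↦ ?_⟩
  have hTT₁ : T₁ ≤ T := (le_max_left _ _).trans hT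
  have hTa₀ : Real.exp a₀ ≤ T := (le_max_right _ _).trans hT
  have hT0 : 0 < T := (Real.exp_pos a₀).trans_le hTa₀
  -- notation `a = log T`, `b = log log T`, `c = log log log T`
  set a : ℝ := Real.log T with ha
  have haa₀ : a₀ ≤ a := by rw [ha, ← Real.log_exp a₀]; exact Real.log_le_log (Real.exp_pos _) hTa₀
  obtain ⟨ha4, hb2π, hbc, hb2640, hE5, hcδ⟩ := ha₀ a haa₀
  set b : ℝ := Real.log a with hb
  set c : ℝ := Real.log b with hc
  have hπ3 := Real.pi_gt_three
  have hb0 : 0 < b := by linarith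
  have hc4 : 4 ≤ c := by
    have : (4 : ℝ) ≤ 4 / δ := by rw [le_div_iff₀ hδ0]; nlinarith
    exact this.trans hcδ
  have hc0 : 0 < c := by linarith
  have ha0 : 0 < a := by linarith
  have hTa : Real.exp a = T := by rw [ha, Real.exp_log hT0]
  have haT : a + 1 ≤ T := by rw [← hTa]; exact Real.add_one_le_exp a
  have hcb : c / b ≤ 1 / 2 := by
    rw [div_le_iff₀ hb0]; linarith only [hbc]
  have hcb0 : 0 ≤ c / b := by positivity
  -- size of `V`: `a/(2b) ≤ V ≤ a/b`
  have hQ : (1 / 2 + (1 / 2 + δ) * (c / b)) * (a / b) = a / (2 * b) + (1 / 2 + δ) * (a * c / b ^ 2) := by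
    field_simp
  have hVl' : a / (2 * b) + (1 / 2 + δ) * (a * c / b ^ 2) ≤ V := by rw [← hQ]; exact hVl
  have hacb : 0 ≤ a * c / b ^ 2 := by positivity
  have hVmin : a / (2 * b) ≤ V := by
    have : 0 ≤ (1 / 2 + δ) * (a * c / b ^ 2) := by positivity
    linarith only [hVl', this]
  have hV0 : 0 < V := lt_of_lt_of_le (by positivity) hVmin
  have hVa : V ≤ a / b := hVu
  have hVa' : V * b ≤ a := by rwa [le_div_iff₀ hb0] at hVa
  -- (i): `x = T^{1/V}` satisfies `log x = a/V ∈ [b, 2b]`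
  have hx_def : Real.log (T ^ (1 / V)) = a / V := by
    rw [Real.log_rpow hT0, ha]; ring
  have hlogx_ge : b ≤ a / V := by
    rw [le_div_iff₀ hV0]; linarith only [hVa', mul_comm V b]
  have hlogx_le : a / V ≤ 2 * b := by
    rw [div_le_iff₀ hV0]
    have := hVmin
    rw [div_le_iff₀ (by positivity)] at this
    linarith only [this]
  have hx2 : (2 : ℝ) ≤ T ^ (1 / V) := by
    have h1 : Real.log 2 ≤ Real.log (T ^ (1 / V)) := by
      rw [hx_def]
      have : Real.log 2 < 1 := by
        have := Real.log_two_lt_d9; linarith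
      linarith
    exact (Real.log_le_log_iff (by norm_num) (Real.rpow_pos_of_pos hT0 _)).1 h1
  have hprime : ∀ σ : ℝ, 1 / 2 ≤ σ → ‖typicalPrimeSum T V σ t‖ ≤ 2 * V := by
    intro σ hσ
    refine (norm_typicalPrimeSum_le (t := t) hx2 hσ).trans ?_
    rw [hx_def]
    set y : ℝ := a / V with hy
    have hy0 : 0 < y := by positivity
    -- `√x = exp(y/2) ≤ exp(b) = a`, so `1320 √x / y² ≤ 1320 a / b²`
    have hsqrt : Real.sqrt (T ^ (1 / V)) ≤ a := by
      have h1 : Real.sqrt (T ^ (1 / V)) = Real.exp (y / 2) := by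
        rw [Real.sqrt_eq_rpow, ← Real.exp_log (Real.rpow_pos_of_pos hT0 (1 / V)), ← Real.exp_mul, hx_def]
        ring_nf
      rw [h1, ← Real.exp_log ha0]
      exact Real.exp_le_exp.2 (by linarith)
    have hterm1 : 1320 * Real.sqrt (T ^ (1 / V)) / y ^ 2 ≤ 1320 * a / b ^ 2 := by
      have hyb : b ^ 2 ≤ y ^ 2 := by nlinarith only [hlogx_ge, hb0]
      calc 1320 * Real.sqrt (T ^ (1 / V)) / y ^ 2 ≤ 1320 * a / y ^ 2 := by gcongr
        _ ≤ 1320 * a / b ^ 2 := by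
            apply div_le_div_of_nonneg_left (by positivity) (by positivity) hyb
    have hterm2 : Real.log y ≤ c + 1 := by
      have h1 : Real.log y ≤ Real.log (2 * b) := Real.log_le_log hy0 hlogx_le
      have h2 : Real.log (2 * b) = Real.log 2 + c := by rw [Real.log_mul (by norm_num) hb0.ne', hc]
      have h3 : Real.log 2 < 1 := by have := Real.log_two_lt_d9; linarith
      linarith only [h1, h2, h3]
    -- now `1320 a/b² + (7/2)(c + 5) ≤ a/b ≤ 2V`
    have hgoal : 1320 * a / b ^ 2 + (7 / 2) * (c + 1 + 4) ≤ a / b := by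
      have h1 : 1320 * a / b ^ 2 ≤ a / (2 * b) := by
        rw [div_le_div_iff₀ (by positivity) (by positivity)]
        have hab : 0 ≤ a * b := by positivity
        have := mul_le_mul_of_nonneg_left hb2640 hab
        nlinarith only [this, hab]
      have h2 : (7 / 2) * (c + 1 + 4) ≤ a / (2 * b) := by
        rw [le_div_iff₀ (by positivity)]
        linarith only [hE5]
      have h3 : a / (2 * b) + a / (2 * b) = a / b := by field_simp; ring
      linarith only [h1, h2, h3]
    have h2V : a / b ≤ 2 * V := by
      have := hVmin
      rw [div_le_iff₀ (by positivity)] at this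
      rw [div_le_iff₀ hb0]; linarith only [this]
    linarith only [hterm1, hterm2, hgoal, h2V]
  -- (ii) and (iii) from Prop. 16 (uniform form, `ε = δ/2`)
  have hGG : ∀ t' h : ℝ, T - 1 ≤ t' → t' ≤ 2 * T + 1 → 0 < h → h ≤ 1 →
      ((zetaZeroCount (t' + h) : ℝ) - zetaZeroCount (t' - h)) ≤
        h / π * a + (a / (2 * b) + (1 / 2 + δ / 2) * a * c / b ^ 2) := by
    intro t' h ht'l ht'u hh0 hh1
    have h1 := hT₁ T hTT₁ t' ht'l ht'u h hh0 hh1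
    have ht'0 : 0 < t' := by linarith only [ht'l, haT, ha4]
    have hlog : Real.log (t' / (2 * π)) ≤ a := by
      rw [ha]
      refine Real.log_le_log (by positivity) ?_
      rw [div_le_iff₀ (by positivity)]
      have : 2 * T + 1 ≤ T * (2 * π) := by nlinarith only [hπ3, haT, ha4]
      linarith only [this, ht'u]
    have h2 : h / π * Real.log (t' / (2 * π)) ≤ h / π * a := mul_le_mul_of_nonneg_left hlog (by positivity)
    linarith only [h1, h2]
  have h58 : (1 / 2 + δ / 2) * a * c / b ^ 2 = (1 / 2 + δ / 2) * (a * c / b ^ 2) := by ring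
  refine ⟨htl, htu, hprime, fun u hul huu ↦ ?_, fun u hul huu ↦ ?_⟩
  · -- (ii): window of length `2πδV/log T`, `h = πδV/a ≤ πδ/b ≤ 1`
    set h : ℝ := π * δ * V / a with hh
    have hh0 : 0 < h := by positivity
    have hh1 : h ≤ 1 := by
      rw [hh, div_le_one ha0]
      calc π * δ * V ≤ π * 1 * (a / b) := by gcongr
        _ ≤ a := by
            rw [mul_one, mul_div_assoc', div_le_iff₀ hb0]; nlinarith only [hb2π, ha0, hπ3]
    have hlen : 2 * π * δ * V / Real.log T = 2 * h := by rw [hh, ← ha]; ring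
    rw [hlen] at huu ⊢
    have := hGG (u + h) h (by linarith) (by linarith) hh0 hh1
    rw [show u + h + h = u + 2 * h by ring, show u + h - h = u by ring] at this
    have hδV : h / π * a = δ * V := by rw [hh]; field_simp
    rw [hδV, h58] at this
    have hmono : (1 / 2 + δ / 2) * (a * c / b ^ 2) ≤ (1 / 2 + δ) * (a * c / b ^ 2) :=
      mul_le_mul_of_nonneg_right (by linarith only [hδ0]) hacb
    linarith only [this, hVl', hmono, hδ0, hV0]
  · -- (iii): window of length `2πV/((log V) log T)`, `h = πV/((log V) a) ≤ 1`
    have hlogV : b / 2 ≤ Real.log V := by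
      have h1 : Real.log (a / (2 * b)) ≤ Real.log V := Real.log_le_log (by positivity) hVmin
      have h2 : Real.log (a / (2 * b)) = b - Real.log (2 * b) := by
        rw [Real.log_div ha0.ne' (by positivity)]
      have h3 : Real.log (2 * b) = Real.log 2 + c := by rw [Real.log_mul (by norm_num) hb0.ne']
      have h4 : Real.log 2 < 1 := by have := Real.log_two_lt_d9; linarith
      linarith only [h1, h2, h3, h4, hbc]
    have hlogV0 : 0 < Real.log V := by linarith only [hlogV, hb0]
    set h : ℝ := π * V / (Real.log V * a) with hh
    have hh0 : 0 < h := by positivity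
    have hVlogV : V / Real.log V ≤ 2 * a / b ^ 2 := by
      rw [div_le_div_iff₀ hlogV0 (by positivity)]
      calc V * b ^ 2 = (V * b) * b := by ring
        _ ≤ a * b := by gcongr
        _ = 2 * a * (b / 2) := by ring
        _ ≤ 2 * a * Real.log V := by gcongr
    have hh1 : h ≤ 1 := by
      rw [hh, div_le_one (by positivity)]
      have : π * V / Real.log V ≤ a := by
        calc π * V / Real.log V = π * (V / Real.log V) := by ring
          _ ≤ π * (2 * a / b ^ 2) := by gcongr
          _ ≤ a := by
              rw [mul_div_assoc', div_le_iff₀ (by positivity)]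
              have hπ4 : π < 4 := Real.pi_lt_four
              have hb2 : 8 ≤ b ^ 2 := by nlinarith only [hb2π, hπ3]
              nlinarith only [hb2, ha0, hπ4]
      rw [div_le_iff₀ hlogV0] at this
      exact this.trans_eq (mul_comm _ _)
    have hlen : 2 * π * V / (Real.log V * Real.log T) = 2 * h := by rw [hh, ← ha]; ring
    rw [hlen] at huu ⊢
    have := hGG (u + h) h (by linarith) (by linarith) hh0 hh1
    rw [show u + h + h = u + 2 * h by ring, show u + h - h = u by ring] at this
    have hhV : h / π * a = V / Real.log V := by rw [hh]; field_simp
    rw [hhV] at this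
    have hsmall : V / Real.log V ≤ (δ / 2) * (a * c / b ^ 2) := by
      refine hVlogV.trans ?_
      rw [show (δ / 2) * (a * c / b ^ 2) = (δ / 2 * a * c) / b ^ 2 by ring,
        div_le_div_iff_of_pos_right (by positivity)]
      -- `2a ≤ (δ/2) a c` since `δ c ≥ 4`
      have hδc : 4 ≤ δ * c := by
        have := mul_le_mul_of_nonneg_left hcδ hδ0.le
        rwa [mul_div_cancel₀ _ hδ0.ne'] at this
      nlinarith only [hδc, ha0]
    rw [h58] at this
    have hsplit : (1 / 2 + δ / 2) * (a * c / b ^ 2) + (δ / 2) * (a * c / b ^ 2) = (1 / 2 + δ) * (a * c / b ^ 2) := by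
      ring
    linarith only [this, hsmall, hVl', hsplit]

end Literature.NumberTheory.LFunctions
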